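import Summits.AtomisticToContinuum.Crystallization.Theorems.FrustratedLawDichotomyLensThree
import Summits.AtomisticToContinuum.Crystallization.Theorems.FrustratedLawDichotomyCapMatchOfDiagonal

/-!
# FrustratedLawDichotomy · crux `AperiodicFrustratedLawGap` (stmt-AtomisticToContinuum-27623) — «NO TWIST» FROM A 12-POINT SCALAR BOUND:
# the `√3`-pairs of an admissible link stay `≥ D₀` apart ⟹ no twisted corner (decomp-a2c, prover hand 2, gen 10)

The two-link certificates `NoTwistCert θ Pat Pat'` (p822065) carry the metric half of P at a corner.  Here the same configuration
statement — at a corner `w` of the link of `i` whose neighbour `τ w` is classified, the correspondence of the four common sites maps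
`Pat`-diagonal pairs to `Pat'`-diagonal pairs — is derived from a SCALAR bound on the centre's link alone plus the three-point lens lemma
(`FrustratedLawDichotomyLensThree.lens_three_false`):  if `{a, b}` (diagonal) were twisted, the diagonal partner `c'` of `a'` inside `C'(w')`
indexes a site `τ c` with `{a, c}` a `√3`-PAIR of `C(w)` (not a contact, not the diagonal partner), and the second common contact `x'` of the
`Pat'`-diagonal pair `{a', c'}` is a THIRD common neighbour `X` of `τ a, τ c` besides `i` and `τ w` — three points within `[nn/(1+θ), (1+θ)²·nn]`
of both, pairwise `≥ nn/(1+θ)` apart, impossible once `‖τ a − τ c‖ ≥ D₀·nn` with `3((1+θ)⁴ − D₀²/4) < (1+θ)⁻² − (((1+θ)⁴ − (1+θ)⁻²)/D₀)²`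
(`θ = 1/100`: any `D₀ ≥ 1.695`; the pyritohedral jitterbug keeps `√3`-pairs at `≈ 1.727`).

* integer facts (by `decide`) + transport: at a corner `w` (fcc: any; hcp: not path-type) a contact `c ≠ a` of `w` that is neither in contact
  with `a` nor its diagonal partner is at distance `√3` (`fcc_/hcp_dist_sqrt_three_of_corner`);
* `LinkPairBound θ D₀ ρ Pat` — the 12-point statement «pattern pairs at distance `ρ` stay `≥ D₀` apart in every admissible link»
  (`ρ = √2`: `LinkDiagonalBound`, p823469; here `ρ = √3`);
* ★ `noTwist_of_pairBound` — the abstract corner lemma (local pattern facts as hypotheses), configuration level;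
* `linkDiagonalBound_iff_pairBound` : `LinkDiagonalBound θ d₀ Pat ↔ LinkPairBound θ d₀ (√2) Pat`.
Next file: half-caps and `CapForcing θ` from the four scalar bounds alone.  `[folklore]`; one definition; no `sorry`; no `instance`/`notation`.
-/

noncomputable section

namespace Summit.AtomisticToContinuum.Crystallization.Theorems.FrustratedLawDichotomyNoTwistOfPairBound

open Literature.Geometry.DiscreteGeometry
open Summit.AtomisticToContinuum.Crystallization.Theorems.FrustratedLawDichotomyTwoShellRigidityCut (E3 LinkIso)
open Summit.AtomisticToContinuum.Crystallization.Theorems.FrustratedLawDichotomyLinkIsoToolkit (injective_of_linkIso)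
open Summit.AtomisticToContinuum.Crystallization.Theorems.FrustratedLawDichotomyCappedRigidityCertPatterns
  (dist_scaledPattern dist_eq_one_iff_sqNormInt dist_eq_sqrt_two_iff_sqNormInt)
open Summit.AtomisticToContinuum.Crystallization.Theorems.FrustratedLawDichotomyCornerPairing
  (exists_partner dist_eq_one_iff_of_partners ncard_common_contacts_scaledPattern exists_int_of_mem_scaledPattern)
open Summit.AtomisticToContinuum.Crystallization.Theorems.FrustratedLawDichotomyBondGraphWindows
  (one_add_pos_of_adj dist_le_mul_dist_of_adj min_dist_lt_dist_of_not_adj)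
open Summit.AtomisticToContinuum.Crystallization.Theorems.FrustratedLawDichotomyNoTwistCert (BondLike)
open Summit.AtomisticToContinuum.Crystallization.Theorems.FrustratedLawDichotomyHalfCap (exists_halfCap_of_diagonal_partners)
open Summit.AtomisticToContinuum.Crystallization.Theorems.FrustratedLawDichotomyNoTwistSwap
  (mem_scaledPattern_of_mem hcpInt_pathType_of_isolated dist_centre_partner_eq_one linkIso_rebase)
open Summit.AtomisticToContinuum.Crystallization.Theorems.FrustratedLawDichotomyCapMatchOfDiagonal (LinkDiagonalBound)
open Summit.AtomisticToContinuum.Crystallization.Theorems.FrustratedLawDichotomyLensThree (lens_three_false)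

variable {θ : ℝ} {Pat Pat' : Finset E3} {N : ℕ} {y : Fin N → E3} {i : Fin N} {τ : ↥Pat → Fin N} {τ' : ↥Pat' → Fin N}

/-! ### §1 The `√3`-pairs of a corner (by `decide`, transported) -/

set_option maxRecDepth 8000 in
/-- fcc (integer model): a contact `c ≠ a` of `w` that is neither in contact with `a` nor diagonal to it is at squared distance `3·2`.
[folklore] -/
theorem fccInt_sqNormInt_six_of_corner : ∀ w ∈ fccInt, ∀ a ∈ fccInt, ∀ c ∈ fccInt,
    sqNormInt (w - a) = ((2 : ℕ) : ℤ) → sqNormInt (w - c) = ((2 : ℕ) : ℤ) → a ≠ c → sqNormInt (a - c) ≠ ((2 : ℕ) : ℤ) →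
      sqNormInt (a - c) ≠ 2 * ((2 : ℕ) : ℤ) → sqNormInt (a - c) = 6 := by
  decide

set_option maxRecDepth 8000 in
/-- hcp (integer model): at a corner without an isolated contact, the same with squared distance `3·18 = 54`. [folklore] -/
theorem hcpInt_sqNormInt_54_of_corner : ∀ w ∈ hcpInt,
    (¬ ∃ d ∈ hcpInt, sqNormInt (w - d) = ((18 : ℕ) : ℤ) ∧
        (hcpInt.filter (fun c => sqNormInt (w - c) = ((18 : ℕ) : ℤ) ∧ sqNormInt (d - c) = ((18 : ℕ) : ℤ))).card = 0) →
      ∀ a ∈ hcpInt, ∀ c ∈ hcpInt, sqNormInt (w - a) = ((18 : ℕ) : ℤ) → sqNormInt (w - c) = ((18 : ℕ) : ℤ) → a ≠ c →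
        sqNormInt (a - c) ≠ ((18 : ℕ) : ℤ) → sqNormInt (a - c) ≠ 2 * ((18 : ℕ) : ℤ) → sqNormInt (a - c) = 54 := by
  decide

/-- Transport of a squared distance `3N` in the integer model to distance `√3` in the scaled pattern. [folklore] -/
theorem dist_eq_sqrt_three_of_sqNormInt {N₀ : ℕ} (hN : N₀ ≠ 0) {v w : Fin 3 → ℤ} (h : sqNormInt (v - w) = 3 * (N₀ : ℤ)) :
    dist ((Real.sqrt N₀)⁻¹ • intVec v : E3) ((Real.sqrt N₀)⁻¹ • intVec w) = Real.sqrt 3 := by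
  rw [dist_scaledPattern hN, h]
  congr 1
  have hN' : (N₀ : ℝ) ≠ 0 := by exact_mod_cast hN
  push_cast
  field_simp

/-- **fcc: the non-contact, non-diagonal partner inside a corner is at distance `√3`.** [folklore] -/
theorem fcc_dist_sqrt_three_of_corner (w a c : ↥fccKissingPattern) (hwa : dist (w : E3) (a : E3) = 1)
    (hwc : dist (w : E3) (c : E3) = 1) (hac : a ≠ c) (h1 : dist (a : E3) (c : E3) ≠ 1) (h2 : dist (a : E3) (c : E3) ≠ Real.sqrt 2) :
    dist (a : E3) (c : E3) = Real.sqrt 3 := by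
  obtain ⟨w₀, hw₀, hwv⟩ := exists_int_of_mem_scaledPattern w
  obtain ⟨a₀, ha₀, hav⟩ := exists_int_of_mem_scaledPattern a
  obtain ⟨c₀, hc₀, hcv⟩ := exists_int_of_mem_scaledPattern c
  have e1 : sqNormInt (w₀ - a₀) = ((2 : ℕ) : ℤ) := by
    rw [← hwv, ← hav] at hwa; exact (dist_eq_one_iff_sqNormInt two_ne_zero w₀ a₀).1 hwa
  have e2 : sqNormInt (w₀ - c₀) = ((2 : ℕ) : ℤ) := by
    rw [← hwv, ← hcv] at hwc; exact (dist_eq_one_iff_sqNormInt two_ne_zero w₀ c₀).1 hwc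
  have e3 : a₀ ≠ c₀ := by intro e; apply hac; apply Subtype.ext; rw [← hav, ← hcv, e]
  have e4 : sqNormInt (a₀ - c₀) ≠ ((2 : ℕ) : ℤ) := by
    intro e; apply h1; rw [← hav, ← hcv]; exact (dist_eq_one_iff_sqNormInt two_ne_zero a₀ c₀).2 e
  have e5 : sqNormInt (a₀ - c₀) ≠ 2 * ((2 : ℕ) : ℤ) := by
    intro e; apply h2; rw [← hav, ← hcv]; exact (dist_eq_sqrt_two_iff_sqNormInt two_ne_zero a₀ c₀).2 e
  have key := fccInt_sqNormInt_six_of_corner w₀ hw₀ a₀ ha₀ c₀ hc₀ e1 e2 e3 e4 e5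
  rw [← hav, ← hcv]
  exact dist_eq_sqrt_three_of_sqNormInt two_ne_zero (by rw [key]; norm_num)

/-- **hcp: at a corner that is not path-type, the non-contact, non-diagonal partner inside the corner is at distance `√3`.** [folklore] -/
theorem hcp_dist_sqrt_three_of_corner (w a c : ↥hcpKissingPattern)
    (hw : ¬ ∃ b : ↥hcpKissingPattern, dist (w : E3) (b : E3) = 1 ∧
      ({d : ↥hcpKissingPattern | dist (w : E3) (d : E3) = 1} ∩ {d : ↥hcpKissingPattern | dist (b : E3) (d : E3) = 1}).ncard = 2)
    (hwa : dist (w : E3) (a : E3) = 1) (hwc : dist (w : E3) (c : E3) = 1) (hac : a ≠ c) (h1 : dist (a : E3) (c : E3) ≠ 1)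
    (h2 : dist (a : E3) (c : E3) ≠ Real.sqrt 2) : dist (a : E3) (c : E3) = Real.sqrt 3 := by
  have h18 : (18 : ℕ) ≠ 0 := by norm_num
  obtain ⟨w₀, hw₀, hwv⟩ := exists_int_of_mem_scaledPattern w
  obtain ⟨a₀, ha₀, hav⟩ := exists_int_of_mem_scaledPattern a
  obtain ⟨c₀, hc₀, hcv⟩ := exists_int_of_mem_scaledPattern c
  have hniso : ¬ ∃ d ∈ hcpInt, sqNormInt (w₀ - d) = ((18 : ℕ) : ℤ) ∧
      (hcpInt.filter (fun c => sqNormInt (w₀ - c) = ((18 : ℕ) : ℤ) ∧ sqNormInt (d - c) = ((18 : ℕ) : ℤ))).card = 0 := by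
    intro hiso
    obtain ⟨b₀, hb₀, hwb, hcard⟩ := hcpInt_pathType_of_isolated w₀ hw₀ hiso
    refine hw ⟨⟨(Real.sqrt (18 : ℕ))⁻¹ • intVec b₀, mem_scaledPattern_of_mem hb₀⟩, ?_, ?_⟩
    · show dist (w : E3) ((Real.sqrt (18 : ℕ))⁻¹ • intVec b₀) = 1
      rw [← hwv]; exact (dist_eq_one_iff_sqNormInt h18 w₀ b₀).2 hwb
    · rw [← ncard_common_contacts_scaledPattern h18 w ⟨(Real.sqrt (18 : ℕ))⁻¹ • intVec b₀, mem_scaledPattern_of_mem hb₀⟩ hwv rfl]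
        at hcard
      exact hcard
  have e1 : sqNormInt (w₀ - a₀) = ((18 : ℕ) : ℤ) := by
    rw [← hwv, ← hav] at hwa; exact (dist_eq_one_iff_sqNormInt h18 w₀ a₀).1 hwa
  have e2 : sqNormInt (w₀ - c₀) = ((18 : ℕ) : ℤ) := by
    rw [← hwv, ← hcv] at hwc; exact (dist_eq_one_iff_sqNormInt h18 w₀ c₀).1 hwc
  have e3 : a₀ ≠ c₀ := by intro e; apply hac; apply Subtype.ext; rw [← hav, ← hcv, e]
  have e4 : sqNormInt (a₀ - c₀) ≠ ((18 : ℕ) : ℤ) := by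
    intro e; apply h1; rw [← hav, ← hcv]; exact (dist_eq_one_iff_sqNormInt h18 a₀ c₀).2 e
  have e5 : sqNormInt (a₀ - c₀) ≠ 2 * ((18 : ℕ) : ℤ) := by
    intro e; apply h2; rw [← hav, ← hcv]; exact (dist_eq_sqrt_two_iff_sqNormInt h18 a₀ c₀).2 e
  have key := hcpInt_sqNormInt_54_of_corner w₀ hw₀ hniso a₀ ha₀ c₀ hc₀ e1 e2 e3 e4 e5
  rw [← hav, ← hcv]
  exact dist_eq_sqrt_three_of_sqNormInt h18 (by rw [key]; norm_num)

/-! ### §2 The scalar bound -/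

/-- **`LinkPairBound θ D₀ ρ Pat` — pattern pairs at distance `ρ` stay at least `D₀` apart in every admissible link.**  For every
`p : Pat → ℝ³` with radial window `1 ≤ ‖p u‖ ≤ 1 + θ`, injective, coupled windows for the centre's bonds and the pattern contacts on the
cluster `{0} ∪ range p`, non-bond strictness for pattern non-contacts: `dist a c = ρ ⟹ D₀ ≤ ‖p a − p c‖`.
[certificate target; 12 points, one scalar; `ρ = √2`: square diagonals (`LinkDiagonalBound`), `ρ = √3`: the `√3`-pairs] -/
def LinkPairBound (θ D₀ ρ : ℝ) (Pat : Finset E3) : Prop :=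
  ∀ p : ↥Pat → E3,
    (∀ u : ↥Pat, 1 ≤ ‖p u‖ ∧ ‖p u‖ ≤ 1 + θ) → Function.Injective p →
    (∀ u : ↥Pat, BondLike θ (insert 0 (Set.range p)) 0 (p u)) →
    (∀ u v : ↥Pat, dist (u : E3) (v : E3) = 1 → BondLike θ (insert 0 (Set.range p)) (p u) (p v)) →
    (∀ u v : ↥Pat, u ≠ v → dist (u : E3) (v : E3) ≠ 1 → min ‖p u‖ ‖p v‖ < ‖p u - p v‖) →
    ∀ a c : ↥Pat, dist (a : E3) (c : E3) = ρ → D₀ ≤ ‖p a - p c‖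

/-- `LinkDiagonalBound θ d₀ Pat ↔ LinkPairBound θ d₀ (√2) Pat`. [folklore] -/
theorem linkDiagonalBound_iff_pairBound {θ d₀ : ℝ} {Pat : Finset E3} :
    LinkDiagonalBound θ d₀ Pat ↔ LinkPairBound θ d₀ (Real.sqrt 2) Pat := Iff.rfl

/-! ### §3 The corner lemma from the `√3`-bound -/

/-- ★ **NO TWISTED CORNER FROM THE `√3`-BOUND (abstract).**  `LinkIso θ Pat y i τ`, corner `w`, neighbour `τ w` with a `Pat'`-classified
link `τ'`, `τ' w' = i`; `a, b ∈ C(w)` a `Pat`-diagonal pair with partners `a', b'`.  Hypotheses: `LinkPairBound θ D₀ √3 Pat`, the numerical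
lens condition, and local pattern facts — «`a'` has a diagonal partner inside `C'(w')`», «the diagonal partner of `a` inside `C(w)` is `b`»,
«a contact of `w` other than `a`, not in contact with `a` and not diagonal to it, is at distance `√3` from `a`», and for `Pat'`: diagonal
pairs have exactly two common contacts, which are not in contact.  Conclusion: `{a', b'}` is a `Pat'`-diagonal pair. [folklore] -/
theorem noTwist_of_pairBound {D₀ : ℝ}
    (hPat : ∀ u v : ↥Pat, u ≠ v → ∃ c : ↥Pat, dist (u : E3) (c : E3) = 1 ∧ dist (v : E3) (c : E3) ≠ 1)
    (hPat' : ∀ u v : ↥Pat', u ≠ v → ∃ c : ↥Pat', dist (u : E3) (c : E3) = 1 ∧ dist (v : E3) (c : E3) ≠ 1)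
    (hB : LinkPairBound θ D₀ (Real.sqrt 3) Pat) (hθ : 0 ≤ θ) (hD₀ : 0 < D₀)
    (hnum : 3 * (((1 + θ) ^ 2) ^ 2 - D₀ ^ 2 / 4) < (1 + θ)⁻¹ ^ 2 - ((((1 + θ) ^ 2) ^ 2 - (1 + θ)⁻¹ ^ 2) / D₀) ^ 2)
    (hy : Function.Injective y) (hL : LinkIso θ Pat y i τ) (w : ↥Pat) (hL' : LinkIso θ Pat' y (τ w) τ')
    {w' : ↥Pat'} (hw' : τ' w' = i) {a b : ↥Pat} {a' b' : ↥Pat'} (ha : dist (w : E3) (a : E3) = 1)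
    (ha' : τ' a' = τ a) (hb' : τ' b' = τ b)
    (hF1 : ∃ c' : ↥Pat', dist (w' : E3) (c' : E3) = 1 ∧ dist (a' : E3) (c' : E3) = Real.sqrt 2)
    (hF2 : ∀ x : ↥Pat, dist (w : E3) (x : E3) = 1 → dist (a : E3) (x : E3) = Real.sqrt 2 → x = b)
    (hS3 : ∀ x : ↥Pat, dist (w : E3) (x : E3) = 1 → a ≠ x → dist (a : E3) (x : E3) ≠ 1 →
      dist (a : E3) (x : E3) ≠ Real.sqrt 2 → dist (a : E3) (x : E3) = Real.sqrt 3)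
    (h2' : ∀ u' v' : ↥Pat', dist (u' : E3) (v' : E3) = Real.sqrt 2 →
      ({c : ↥Pat' | dist (u' : E3) (c : E3) = 1} ∩ {c : ↥Pat' | dist (v' : E3) (c : E3) = 1}).ncard = 2)
    (hna' : ∀ u' v' c c' : ↥Pat', dist (u' : E3) (v' : E3) = Real.sqrt 2 → dist (u' : E3) (c : E3) = 1 → dist (v' : E3) (c : E3) = 1 →
      dist (u' : E3) (c' : E3) = 1 → dist (v' : E3) (c' : E3) = 1 → c ≠ c' → dist (c : E3) (c' : E3) ≠ 1) :
    dist (a' : E3) (b' : E3) = Real.sqrt 2 := by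
  classical
  by_contra hne
  have hτ : Function.Injective τ := injective_of_linkIso hPat hL
  have hτ' : Function.Injective τ' := injective_of_linkIso hPat' hL'
  have hLw : LinkIso θ Pat y (τ' w') τ := linkIso_rebase hL hw'
  have hw'a' : dist (w' : E3) (a' : E3) = 1 := dist_centre_partner_eq_one hL w hL' hw' ha'
  -- the diagonal partner c' of a' inside C'(w') and its partner c ∈ C(w)
  obtain ⟨c', hc'w, hac'⟩ := hF1
  have hc'b' : c' ≠ b' := fun h => hne (by rw [← h]; exact hac')
  obtain ⟨c, hcw, hc, -⟩ := exists_partner hτ hL' w' hLw (w' := w) rfl hc'w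
  -- {a, c} is a √3-pair of C(w)
  have hsqrt2_ne_one : Real.sqrt 2 ≠ 1 := by
    intro h
    have := Real.sqrt_eq_one.1 h
    norm_num at this
  have hca : a ≠ c := by
    intro h
    have : c' = a' := hτ' (by rw [← hc, ← h, ha'])
    rw [this, dist_self] at hac'
    exact (Real.sqrt_pos.2 (by norm_num : (0 : ℝ) < 2)).ne hac'
  have hcb : c ≠ b := by
    intro h
    exact hc'b' (hτ' (by rw [← hc, h, hb']))
  have hac1 : dist (a : E3) (c : E3) ≠ 1 := by
    intro h
    have := (dist_eq_one_iff_of_partners hL w hL' ha' hc.symm).1 h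
    rw [hac'] at this
    exact hsqrt2_ne_one this
  have hac2 : dist (a : E3) (c : E3) ≠ Real.sqrt 2 := fun h => hcb (hF2 c hcw h)
  have hac3 : dist (a : E3) (c : E3) = Real.sqrt 3 := hS3 c hcw hca hac1 hac2
  -- the third common neighbour X of τ a, τ c
  obtain ⟨X, hXi, hXa, hXc, hXw, hXr⟩ := exists_halfCap_of_diagonal_partners hτ' hL w hL' hw' hw'a' hc'w ha' hc.symm hac'
    (h2' a' c' hac') (fun d d' h1 h2 h3 h4 hne' => hna' a' c' d d' hac' h1 h2 h3 h4 hne')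
  -- rescale about y i with unit nearestDist y i
  have hθpos : 0 < 1 + θ := by linarith
  set r : ℝ := nearestDist y i with hr_def
  have hwi : τ w ≠ i := fun h => (hL.1 w).ne h.symm
  have hr0 : 0 < r := by
    obtain ⟨k₀, hk₀, hr⟩ := exists_nearestDist_eq_dist y (j := i) ⟨τ w, hwi⟩
    rw [hr_def, hr]
    exact dist_pos.2 fun h => hk₀ (hy h).symm
  have hri : 0 < r⁻¹ := inv_pos.2 hr0
  set q : Fin N → E3 := fun j => r⁻¹ • (y j - y i) with hq_def
  have hq_sub : ∀ j l, ‖q j - q l‖ = r⁻¹ * dist (y j) (y l) := by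
    intro j l
    simp only [hq_def]
    rw [← smul_sub, sub_sub_sub_cancel_right, norm_smul, Real.norm_of_nonneg hri.le, dist_eq_norm]
  have hqi : q i = 0 := by simp [hq_def]
  have hq_norm : ∀ j, ‖q j‖ = r⁻¹ * dist (y j) (y i) := by
    intro j
    have := hq_sub j i
    rwa [hqi, sub_zero] at this
  have hq_inj : Function.Injective q := by
    intro j l h
    have h0 : ‖q j - q l‖ = 0 := by rw [h, sub_self, norm_zero]
    rw [hq_sub] at h0
    rcases mul_eq_zero.1 h0 with h1 | h1
    · exact absurd h1 hri.ne'
    · exact hy (dist_eq_zero.1 h1)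
  have sA : ∀ j, j ≠ i → 1 ≤ ‖q j‖ := by
    intro j hj
    rw [hq_norm, dist_comm]
    have := nearestDist_le_dist y hj
    rw [← hr_def] at this
    calc (1 : ℝ) = r⁻¹ * r := by field_simp
      _ ≤ r⁻¹ * dist (y i) (y j) := mul_le_mul_of_nonneg_left this hri.le
  have sR : ∀ j, (bondGraph θ y).Adj i j → ‖q j‖ ≤ 1 + θ := by
    intro j hj
    rw [hq_norm, dist_comm]
    have h1 : dist (y i) (y j) ≤ (1 + θ) * r := dist_le_of_adj hθpos.le hj
    calc r⁻¹ * dist (y i) (y j) ≤ r⁻¹ * ((1 + θ) * r) := mul_le_mul_of_nonneg_left h1 hri.le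
      _ = 1 + θ := by field_simp
  have sB : ∀ j k l, (bondGraph θ y).Adj j k → l ≠ j → ‖q j - q k‖ ≤ (1 + θ) * ‖q j - q l‖ := by
    intro j k l hjk hlj
    rw [hq_sub, hq_sub]
    calc r⁻¹ * dist (y j) (y k) ≤ r⁻¹ * ((1 + θ) * dist (y j) (y l)) :=
          mul_le_mul_of_nonneg_left (dist_le_mul_dist_of_adj hθpos.le hjk hlj) hri.le
      _ = (1 + θ) * (r⁻¹ * dist (y j) (y l)) := by ring
  have sB' : ∀ j k l, (bondGraph θ y).Adj j k → l ≠ k → ‖q j - q k‖ ≤ (1 + θ) * ‖q k - q l‖ := by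
    intro j k l hjk hlk
    rw [norm_sub_rev (q j)]
    exact sB k j l hjk.symm hlk
  have sN : ∀ j k j' k', j ≠ k → ¬ (bondGraph θ y).Adj j k → (bondGraph θ y).Adj j j' → (bondGraph θ y).Adj k k' →
      min ‖q j - q j'‖ ‖q k - q k'‖ < ‖q j - q k‖ := by
    intro j k j' k' hjk hnot hj hk
    rw [hq_sub, hq_sub, hq_sub, ← mul_min_of_nonneg _ _ hri.le]
    exact mul_lt_mul_of_pos_left (min_dist_lt_dist_of_not_adj hθpos.le hjk hnot hj hk) hri
  -- the scalar bound applied to the centre's link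
  set p : ↥Pat → E3 := fun u => q (τ u) with hp_def
  have hτi : ∀ u, τ u ≠ i := fun u h => (hL.1 u).ne h.symm
  have hK : ∀ {Z} {j : Fin N}, Z ∈ insert (0 : E3) (Set.range p) → Z ≠ q j → ∃ l, l ≠ j ∧ q l = Z := by
    intro Z j hZ hneq
    rcases hZ with rfl | ⟨u, rfl⟩
    · exact ⟨i, fun h => hneq (by rw [← h, hqi]), hqi⟩
    · exact ⟨τ u, fun h => hneq (by simp [hp_def, h]), rfl⟩
  have bondLike : ∀ {j k : Fin N}, (bondGraph θ y).Adj j k → BondLike θ (insert 0 (Set.range p)) (q j) (q k) := by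
    intro j k hjk
    refine ⟨fun Z hZ hneq => ?_, fun Z hZ hneq => ?_⟩
    · obtain ⟨l, hl, rfl⟩ := hK hZ hneq
      exact sB j k l hjk hl
    · obtain ⟨l, hl, rfl⟩ := hK hZ hneq
      exact sB' j k l hjk hl
  have hAC : D₀ ≤ dist (q (τ a)) (q (τ c)) := by
    rw [dist_eq_norm]
    refine hB p (fun u => ⟨sA _ (hτi u), sR _ (hL.1 u)⟩) (hq_inj.comp hτ)
      (fun u => by have := bondLike (hL.1 u); rwa [hqi] at this) (fun u v huv => bondLike ((hL.2.2 u v).2 huv))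
      (fun u v huv hd => ?_) a c hac3
    have hnot : ¬ (bondGraph θ y).Adj (τ u) (τ v) := fun h => hd ((hL.2.2 u v).1 h)
    have := sN (τ u) (τ v) i i (hτ.ne huv) hnot (hL.1 u).symm (hL.1 v).symm
    simpa [hqi] using this
  -- adjacency facts
  have hwa_adj : (bondGraph θ y).Adj (τ w) (τ a) := (hL.2.2 w a).2 ha
  have hwc_adj : (bondGraph θ y).Adj (τ w) (τ c) := (hL.2.2 w c).2 hcw
  have hXτa : X ≠ τ a := fun h => hXr ⟨a, h.symm⟩
  have hXτc : X ≠ τ c := fun h => hXr ⟨c, h.symm⟩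
  have hXτw : X ≠ τ w := fun h => hXr ⟨w, h.symm⟩
  have hwa_ne : τ w ≠ τ a := hwa_adj.ne
  have hwc_ne : τ w ≠ τ c := hwc_adj.ne
  set lam : ℝ := 1 + θ with hlam
  have hlam1 : 1 ≤ lam := by rw [hlam]; linarith
  -- window: a neighbour Q of the link point L = q (τ u) (adjacent to i): 1/λ ≤ ‖L − Q‖ ≤ λ²
  have winA : ∀ (u : ↥Pat) (m : Fin N), (bondGraph θ y).Adj (τ u) m → m ≠ τ u →
      lam⁻¹ ^ 2 ≤ dist (q m) (q (τ u)) ^ 2 ∧ dist (q m) (q (τ u)) ^ 2 ≤ (lam ^ 2) ^ 2 := by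
    intro u m hadj hm
    have hup : ‖q (τ u) - q m‖ ≤ lam ^ 2 := by
      have h1 := sB (τ u) m i hadj (hτi u).symm
      rw [hqi, sub_zero] at h1
      nlinarith [sR _ (hL.1 u), sA _ (hτi u)]
    have hlow : lam⁻¹ ≤ ‖q (τ u) - q m‖ := by
      have h1 := sB (τ u) i m (hL.1 u).symm hm
      rw [hqi, sub_zero] at h1
      rw [inv_le_iff_one_le_mul₀ hθpos]
      nlinarith [sA _ (hτi u)]
    rw [dist_eq_norm, norm_sub_rev]
    exact ⟨pow_le_pow_left₀ (inv_nonneg.2 hθpos.le) hlow 2, pow_le_pow_left₀ (norm_nonneg _) hup 2⟩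
  have win0 : ∀ u : ↥Pat, lam⁻¹ ^ 2 ≤ dist (0 : E3) (q (τ u)) ^ 2 ∧ dist (0 : E3) (q (τ u)) ^ 2 ≤ (lam ^ 2) ^ 2 := by
    intro u
    rw [dist_comm, dist_eq_norm, sub_zero]
    have h1 : lam⁻¹ ≤ ‖q (τ u)‖ := (inv_le_one_of_one_le₀ hlam1).trans (sA _ (hτi u))
    have h2 : ‖q (τ u)‖ ≤ lam ^ 2 := (sR _ (hL.1 u)).trans (by nlinarith)
    exact ⟨pow_le_pow_left₀ (inv_nonneg.2 hθpos.le) h1 2, pow_le_pow_left₀ (norm_nonneg _) h2 2⟩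
  -- the three common neighbours 0, q (τ w), q X of q (τ a), q (τ c)
  let P : Fin 3 → E3 := ![0, q (τ w), q X]
  refine lens_three_false (A := q (τ a)) (B := q (τ c)) (P := P) (D₀ := D₀) (lo := lam⁻¹ ^ 2) (hi := (lam ^ 2) ^ 2)
    (s := lam⁻¹) hD₀ hAC ?_ ?_ (inv_nonneg.2 hθpos.le) ?_ hnum
  · intro k
    fin_cases k
    · simpa [P] using win0 a
    · simpa [P] using winA a (τ w) hwa_adj.symm hwa_ne
    · simpa [P] using winA a X hXa.symm hXτa
  · intro k
    fin_cases k
    · simpa [P] using win0 c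
    · simpa [P] using winA c (τ w) hwc_adj.symm hwc_ne
    · simpa [P] using winA c X hXc.symm hXτc
  · -- separations
    have d01 : lam⁻¹ ≤ dist (0 : E3) (q (τ w)) := by
      rw [dist_comm, dist_eq_norm, sub_zero]; exact (inv_le_one_of_one_le₀ hlam1).trans (sA _ hwi)
    have d02 : lam⁻¹ ≤ dist (0 : E3) (q X) := by
      rw [dist_comm, dist_eq_norm, sub_zero]; exact (inv_le_one_of_one_le₀ hlam1).trans (sA _ hXi)
    have d12 : lam⁻¹ ≤ dist (q (τ w)) (q X) := by
      have h1 := sB (τ w) i X (hL.1 w).symm hXτw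
      rw [hqi, sub_zero] at h1
      rw [dist_eq_norm, inv_le_iff_one_le_mul₀ hθpos]
      nlinarith [sA _ hwi]
    intro j k hjk
    fin_cases j <;> fin_cases k <;> simp at hjk
    · simpa [P] using d01
    · simpa [P] using d02
    · simpa [P, dist_comm] using d01
    · simpa [P] using d12
    · simpa [P, dist_comm] using d02
    · simpa [P, dist_comm] using d12

end Summit.AtomisticToContinuum.Crystallization.Theorems.FrustratedLawDichotomyNoTwistOfPairBound

end
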